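import Mathlib
import HarnessLib
import Summits.ValiantsHypothesis.ValiantsHypothesis.Theorems.MonotoneRestorationOrbitRestorationQPNormalisedFactors

/-!
# Label blocks of a matrix-symmetric affine product are transported up to units (SPAN currency; block transport)

Route MonotoneRestoration, crux `OrbitRestorationQP` (stmt-ValiantsHypothesis-18293), SPAN-currency lane of the open
sub-rung A_∞ (`stub_sigmaPiSigmaValue`), `ΠΣ` part, twisted residue.  Helper (`--supports`), def-free.  The
`Sym_n × Sym_n` version of `SupportBlocks.exists_unit_block` / `TermBlocks.exists_unit_labelBlock` (which are stated for
the diagonal action):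

* **`exists_unit_labelBlock_rowCol`** — let `C a · Π_i L_i ≠ 0` (degree-one factors) be fixed by the renaming
  `(p,q) ↦ (σ p, τ q)`, and let `lab` be a labelling of polynomials that is invariant under nonzero scalars and
  EQUIVARIANT (`lab ((σ,τ) · q) = act (lab q)` for an injective `act` on labels — e.g. the pair of row/column supports
  of `LocalFactors.exists_rowColSupports_of_matrixSymmetric`, `act (R, C) = (σ • R, τ • C)`).  Then the BLOCK of label
  `l` (the product of the factors with label `l`) is carried by the renaming to a nonzero constant multiple of the block
  of label `act l`.

With `NormalisedFactors.exists_rescaling_of_eigenFree_transport` (cocycle trivialisation) and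
`CorePatterns.prod_mem_narrowSpan_of_stable_localPolyUFactors` (exactly permuted placed polynomial local forms), this
is the transport step of the BLOCK-UNTWISTED case.  No registered stub is closed; the crux and VP ≠ VNP are not moved.
[folklore]
-/

noncomputable section

-- `Summit.ValiantsHypothesis.ValiantsHypothesis.…` is the tree's single-conjunct layout (Sub = Summit).
set_option linter.dupNamespace false

namespace Summit.ValiantsHypothesis.ValiantsHypothesis.Theorems

namespace NormalisedFactors

open MvPolynomial Finset Equiv ProductAction

variable {n : ℕ}

/-- **Label blocks are transported up to units by a row/column renaming.** [folklore] -/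
theorem exists_unit_labelBlock_rowCol {ι Λ : Type} [Fintype ι] [DecidableEq Λ] (L : ι → MvPolynomial (Fin n × Fin n) ℂ)
    (a : ℂ) (hL1 : ∀ i, (L i).totalDegree = 1) (hf0 : C a * ∏ i, L i ≠ 0) (σ τ : Perm (Fin n))
    (hfix : rename (fun P : Fin n × Fin n => (σ P.1, τ P.2)) (C a * ∏ i, L i) = C a * ∏ i, L i)
    (lab : MvPolynomial (Fin n × Fin n) ℂ → Λ) (act : Λ → Λ) (hact : Function.Injective act)
    (L1 : ∀ (q : MvPolynomial (Fin n × Fin n) ℂ) (u : ℂ), u ≠ 0 → lab (C u * q) = lab q)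
    (L2 : ∀ i, lab (rename (fun P : Fin n × Fin n => (σ P.1, τ P.2)) (L i)) = act (lab (L i))) (l : Λ) :
    ∃ c : ℂ, c ≠ 0 ∧
      rename (fun P : Fin n × Fin n => (σ P.1, τ P.2)) (∏ i ∈ (univ : Finset ι).filter (fun i => lab (L i) = l), L i) =
        C c * ∏ i ∈ (univ : Finset ι).filter (fun i => lab (L i) = act l), L i := by
  classical
  set φ : MvPolynomial (Fin n × Fin n) ℂ →ₐ[ℂ] MvPolynomial (Fin n × Fin n) ℂ :=
    rename (fun P : Fin n × Fin n => (σ P.1, τ P.2)) with hφ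
  have hrel := rel_associated_of_rename_prod_eq L a hL1 hf0 σ τ hfix
  rw [Associates.rel_associated_iff_map_eq_map] at hrel
  -- filter by the label `act l`
  have hP : ∀ p q : MvPolynomial (Fin n × Fin n) ℂ, Associated p q → (lab p = act l ↔ lab q = act l) := by
    intro p q hpq
    obtain ⟨c, hc0, rfl⟩ := SupportBlocks.exists_C_of_associated hpq
    rw [L1 p c hc0]
  have h1 := SupportBlocks.map_mk_filter_eq hP hrel
  -- the filtered renamed multiset is the renamed block of label `l`
  have h2 : (((univ : Finset ι).val.map L).map φ).filter (fun q => lab q = act l) =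
      (((univ : Finset ι).filter fun i => lab (L i) = l).val.map L).map φ := by
    rw [Multiset.filter_map, Multiset.filter_map, Finset.filter_val]
    congr 2
    refine Multiset.filter_congr fun i _ => ?_
    simp only [Function.comp_apply, hφ]
    rw [L2 i]
    exact hact.eq_iff
  have h3 : ((univ : Finset ι).val.map L).filter (fun q => lab q = act l) =
      ((univ : Finset ι).filter fun i => lab (L i) = act l).val.map L := by
    rw [Multiset.filter_map, Finset.filter_val]
    rfl
  rw [h2, h3] at h1
  have h4 := congrArg Multiset.prod h1
  rw [Associates.prod_mk, Associates.prod_mk, Associates.mk_eq_mk_iff_associated, ← map_multiset_prod,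
    ← Finset.prod_eq_multiset_prod, ← Finset.prod_eq_multiset_prod] at h4
  obtain ⟨c, hc0, hc⟩ := SupportBlocks.exists_C_of_associated h4.symm
  refine ⟨c, hc0, ?_⟩
  rw [← hc, hφ, map_prod]

end NormalisedFactors

end Summit.ValiantsHypothesis.ValiantsHypothesis.Theorems

end
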